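import Literature.Barriers.ABC.BakerMethodBoundsStewartYuProofs
import HarnessLib

/-!
# Proofs for `BakerMethodBounds`, IV: the Stewart–Yu bound from the three place bounds alone

`Literature/Barriers/ABC/BakerMethodBoundsPlaceBoundsProofs.lean` — proofs companion of the barrier
file `Literature/Barriers/ABC/BakerMethodBounds.lean` (theorems only; no definition, no named fact).

`BakerMethodBoundsThreeRoutesProofs.lean` and `BakerMethodBoundsStewartYuProofs.lean` prove
`BakerMethodBounds = BakerShapeBound (1/3) 3` (Stewart–Yu 2001, Theorem 1: an absolute `κ` with
`log c ≤ κ R^{1/3} (log R)³` for all coprime positive `a + b = c`, `R = rad(abc)`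
[cite: StewartYu2001, Theorem 1]) from Pasten's approximation bound
`PastenApproximationBound K` [cite: Pasten2024, Theorem 2.1], which quantifies over ALL finite
families of non-torsion rational generators — and is obtained in the tree only through
Evertse–Győry's Theorem 4.2.1 over `ℚ` (Matveev 2000 + Yu 2007 + geometry of numbers). The
deduction, however, consumes the approximation bound at exactly three places, always at threshold
`N = 0`, i.e. for the generator family "the primes of `uv`" (`theta K u v 0 = K^{ω(uv)+1} ∏_{q ∣ uv} log q`,
`theta_zero_eq`):

* (∞) `log c − log a < Θ_{bc} · Y` (`Pasten.arch_bound … 0`),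
* (p ∣ a) `ν_p(a) log p < Θ_{bc} · (p / log p)(log p + Y)` (`Pasten.padic_bound_a … 0`),
* (p ∣ c) `ν_p(c) log p < Θ_{ab} · (p / log p)(log p + Y)` for `ab > 1` (`Pasten.padic_bound_c … 0`),

with `Y = log max{e, 2 log c}`. This file re-runs steps 1–3 of the deduction (routes, cube,
self-improvement; see the module docstring of `BakerMethodBoundsThreeRoutesProofs.lean`) with these
three PLACE BOUNDS as hypotheses instead of `PastenApproximationBound K`:

* `log_lt_route_a_of_placeBounds`, `log_lt_route_c_of_placeBounds`,
  `log_pow_three_le_of_placeBounds` — verbatim re-runs of `log_lt_route_a/c`, `log_pow_three_le`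
  (the `b`-route is the `a`-route of the swapped triple `(b, a, c)`);
* `bakerShapeBound_third_three_of_placeBounds`, `BakerMethodBounds_of_placeBounds` — the barrier
  declaration from the three place bounds (for some `K ≥ 1`);
* conversely nothing is lost: `PastenApproximationBound K` gives the three place bounds
  (`Pasten.arch_bound`, `Pasten.padic_bound_a`, `Pasten.padic_bound_c` at `N = 0`), so
  `BakerMethodBounds_of_placeBounds hK (fun h => arch_bound hK hP h 0) (fun h _ hp hpa =>
  padic_bound_a hK hP h 0 hp hpa) (fun h h1 _ hp hpc => padic_bound_c hK hP h h1 0 hp hpc)`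
  re-proves the tree's `BakerMethodBounds_of_approximationBound hK hP` (checked while writing this
  file; not restated as a declaration).

The point: the place bounds concern linear forms in logarithms of DISTINCT PRIMES only
(multiplicatively independent, heights `log q`, exponents bounded by `log c / log 2 ≤ 2 h(ξ)`), so
they follow from lower bounds for linear forms in logarithms stated for multiplicatively
independent rationals with the exponent size `B` (not the height of `ξ`) in the logarithm — e.g.
Nesterenko's theorem for rational numbers (Lecture Notes in Math. 1819 (2003), Thm 2.1:
`log |Λ| ≥ −2.9 (2e)^{2n+6} (n+2)^{9/2} h(α₁)⋯h(αₙ) log(eB)`) at the infinite place — without the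
passage through Evertse–Győry's Theorem 4.2.1 (height-minimal systems of generators, Proposition
4.4.1) that arbitrary generator families require. That derivation is the business of a sibling file;
here only the formal reduction of the barrier declaration to the three place bounds is recorded.

## References

* [StewartYu2001] C. L. Stewart, K. Yu, *On the abc conjecture, II*, Duke Math. J. 108 (2001),
  169–181 — Theorem 1.
* [Pasten2024] H. Pasten, Invent. Math. 236 (2024), 373–385 — Theorem 2.1, §§4–5.
* [BakerWustholz2007] A. Baker, G. Wüstholz, *Logarithmic Forms and Diophantine Geometry*, CUP 2007
  — §3.7 (the Stewart–Yu bound `log max(|a|,|b|,|c|) ≪ N^{1/3}(log N)³` and its inputs).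
-/

noncomputable section

open Finset Real Height
open Literature.NumberTheory.DiophantineGeometry
open Literature.NumberTheory.DiophantineGeometry.Dioph
open Literature.NumberTheory.DiophantineGeometry.Pasten

namespace Literature.Barriers.ABC

section PlaceBounds

variable {K : ℝ}

/-- **Route through `a` from the place bounds**: if (∞) `log c − log a < Θ_{bc} Y` and
(p ∣ a) `ν_p(a) log p < Θ_{bc} (p/log p)(log p + Y)` hold for the abc triple `(a, b, c)`
(`Θ_{bc} = theta K b c 0`, `Y = log max{e, 2 log c}`, `K ≥ 1`), then
`log c < Θ_{bc} · Y · (1 + 3 ∑_{p ∣ a} p)`. The proof of `log_lt_route_a`, with the two place bounds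
as hypotheses. [cite: StewartYu2001, Theorem 1 (proof, as reconstructed in `BakerMethodBoundsThreeRoutesProofs`)] -/
theorem log_lt_route_a_of_placeBounds (hK : 1 ≤ K) {a b c : ℕ} (h : IsABCTriple a b c)
    (harch : Real.log c - Real.log a <
      theta K b c 0 * Real.log (max (Real.exp 1) (2 * Real.log c)))
    (hpad : ∀ {p : ℕ}, p.Prime → p ∣ a →
      (a.factorization p : ℝ) * Real.log p < theta K b c 0 *
        ((p / Real.log p) * (Real.log p + Real.log (max (Real.exp 1) (2 * Real.log c))))) :
    Real.log c < theta K b c 0 * Real.log (max (Real.exp 1) (2 * Real.log c)) *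
      (1 + 3 * ∑ p ∈ a.primeFactors, (p : ℝ)) := by
  obtain ⟨ha, hb, habc, hcop⟩ := id h
  set Θ := theta K b c 0 with hΘ
  set Y := Real.log (max (Real.exp 1) (2 * Real.log c)) with hY
  have hY1 : 1 ≤ Y := one_le_log_max_exp _
  have hΘ0 : 0 ≤ Θ := theta_nonneg (zero_le_one.trans hK) b c 0
  have hloga : Real.log a = ∑ p ∈ a.primeFactors, (a.factorization p : ℝ) * Real.log p :=
    log_eq_sum_factorization_mul_log ha.ne'
  have hsum : ∑ p ∈ a.primeFactors, (a.factorization p : ℝ) * Real.log p ≤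
      ∑ p ∈ a.primeFactors, Θ * (3 * p * Y) := by
    refine Finset.sum_le_sum fun p hp => ?_
    have hp' := Nat.prime_of_mem_primeFactors hp
    have hpa := Nat.dvd_of_mem_primeFactors hp
    have h1 := hpad hp' hpa
    have h2 : (p : ℝ) / Real.log p * (Real.log p + Y) ≤ 3 * p * Y :=
      div_log_mul_add_le (by exact_mod_cast hp'.two_le) hY1
    exact (h1.trans_le (mul_le_mul_of_nonneg_left h2 hΘ0)).le
  have hsum' : ∑ p ∈ a.primeFactors, Θ * (3 * p * Y) =
      Θ * Y * (3 * ∑ p ∈ a.primeFactors, (p : ℝ)) := by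
    rw [Finset.mul_sum, Finset.mul_sum]
    exact Finset.sum_congr rfl fun p _ => by ring
  have hloga' : Real.log a ≤ Θ * Y * (3 * ∑ p ∈ a.primeFactors, (p : ℝ)) := by
    rw [hloga, ← hsum']; exact hsum
  calc Real.log c = (Real.log c - Real.log a) + Real.log a := by ring
    _ < Θ * Y + Θ * Y * (3 * ∑ p ∈ a.primeFactors, (p : ℝ)) := add_lt_add_of_lt_of_le harch hloga'
    _ = Θ * Y * (1 + 3 * ∑ p ∈ a.primeFactors, (p : ℝ)) := by ring

/-- **Route through `c` from the place bound** (p ∣ c): if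
`ν_p(c) log p < Θ_{ab} (p/log p)(log p + Y)` for every prime `p ∣ c` (`Θ_{ab} = theta K a b 0`,
`K ≥ 1`), then `log c < Θ_{ab} · Y · (1 + 3 ∑_{p ∣ c} p)`. The proof of `log_lt_route_c`.
[cite: StewartYu2001, Theorem 1 (proof, as reconstructed in `BakerMethodBoundsThreeRoutesProofs`)] -/
theorem log_lt_route_c_of_placeBounds (hK : 1 ≤ K) {a b c : ℕ} (h : IsABCTriple a b c)
    (hpadc : ∀ {p : ℕ}, p.Prime → p ∣ c →
      (c.factorization p : ℝ) * Real.log p < theta K a b 0 *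
        ((p / Real.log p) * (Real.log p + Real.log (max (Real.exp 1) (2 * Real.log c))))) :
    Real.log c < theta K a b 0 * Real.log (max (Real.exp 1) (2 * Real.log c)) *
      (1 + 3 * ∑ p ∈ c.primeFactors, (p : ℝ)) := by
  obtain ⟨ha, hb, habc, hcop⟩ := id h
  set Θ := theta K a b 0 with hΘ
  set Y := Real.log (max (Real.exp 1) (2 * Real.log c)) with hY
  have hc : c ≠ 0 := by omega
  have hY1 : 1 ≤ Y := one_le_log_max_exp _
  have hΘpos : 0 < Θ := theta_zero_pos hK ha.ne' hb.ne' hcop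
  have hΘ0 : 0 ≤ Θ := hΘpos.le
  have hlogc : Real.log c = ∑ p ∈ c.primeFactors, (c.factorization p : ℝ) * Real.log p :=
    log_eq_sum_factorization_mul_log hc
  have hsum : ∑ p ∈ c.primeFactors, (c.factorization p : ℝ) * Real.log p ≤
      ∑ p ∈ c.primeFactors, Θ * (3 * p * Y) := by
    refine Finset.sum_le_sum fun p hp => ?_
    have hp' := Nat.prime_of_mem_primeFactors hp
    have hpc := Nat.dvd_of_mem_primeFactors hp
    have h1' := hpadc hp' hpc
    have h2 : (p : ℝ) / Real.log p * (Real.log p + Y) ≤ 3 * p * Y :=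
      div_log_mul_add_le (by exact_mod_cast hp'.two_le) hY1
    exact (h1'.trans_le (mul_le_mul_of_nonneg_left h2 hΘ0)).le
  have hsum' : ∑ p ∈ c.primeFactors, Θ * (3 * p * Y) =
      Θ * Y * (3 * ∑ p ∈ c.primeFactors, (p : ℝ)) := by
    rw [Finset.mul_sum, Finset.mul_sum]
    exact Finset.sum_congr rfl fun p _ => by ring
  have hΘY : 0 < Θ * Y := mul_pos hΘpos (lt_of_lt_of_le one_pos hY1)
  calc Real.log c = ∑ p ∈ c.primeFactors, (c.factorization p : ℝ) * Real.log p := hlogc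
    _ ≤ Θ * Y * (3 * ∑ p ∈ c.primeFactors, (p : ℝ)) := by rw [← hsum']; exact hsum
    _ < Θ * Y + Θ * Y * (3 * ∑ p ∈ c.primeFactors, (p : ℝ)) := by linarith
    _ = Θ * Y * (1 + 3 * ∑ p ∈ c.primeFactors, (p : ℝ)) := by ring

/-- **The cube of the three routes from the place bounds**, for an abc triple (the hypotheses are
satisfiable only when `ab > 1`, cf. `bakerShapeBound_third_three_of_placeBounds`):
if the archimedean bound holds for `(a, b, c)` and for `(b, a, c)`, the `p ∣ a` bound for the
primes of `a` (with `Θ_{bc}`) and of `b` (with `Θ_{ac}`, i.e. for the triple `(b, a, c)`), and the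
`p ∣ c` bound for the primes of `c`, then `(log c)³ ≤ 64 K⁹ C³ Λ⁶ Y³ R` (`R = rad(abc)`,
`Λ = max(1, log R)`, `Y = log max{e, 2 log c}`, `C` bounding the products `∏ 4K²(log p)²/p`).
The proof of `log_pow_three_le`. [cite: StewartYu2001, Theorem 1 (proof, as reconstructed in `BakerMethodBoundsThreeRoutesProofs`)] -/
theorem log_pow_three_le_of_placeBounds (hK : 1 ≤ K) {C : ℝ} (hC1 : 1 ≤ C)
    (hC : ∀ S : Finset ℕ, (∀ p ∈ S, p.Prime) → ∏ p ∈ S, 4 * K ^ 2 * Real.log p ^ 2 / p ≤ C)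
    {a b c : ℕ} (h : IsABCTriple a b c)
    (harchA : Real.log c - Real.log a <
      theta K b c 0 * Real.log (max (Real.exp 1) (2 * Real.log c)))
    (harchB : Real.log c - Real.log b <
      theta K a c 0 * Real.log (max (Real.exp 1) (2 * Real.log c)))
    (hpadA : ∀ {p : ℕ}, p.Prime → p ∣ a →
      (a.factorization p : ℝ) * Real.log p < theta K b c 0 *
        ((p / Real.log p) * (Real.log p + Real.log (max (Real.exp 1) (2 * Real.log c)))))
    (hpadB : ∀ {p : ℕ}, p.Prime → p ∣ b →
      (b.factorization p : ℝ) * Real.log p < theta K a c 0 *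
        ((p / Real.log p) * (Real.log p + Real.log (max (Real.exp 1) (2 * Real.log c)))))
    (hpadC : ∀ {p : ℕ}, p.Prime → p ∣ c →
      (c.factorization p : ℝ) * Real.log p < theta K a b 0 *
        ((p / Real.log p) * (Real.log p + Real.log (max (Real.exp 1) (2 * Real.log c))))) :
    Real.log c ^ 3 ≤ 64 * K ^ 9 * C ^ 3 * max 1 (Real.log (rad a b c : ℕ)) ^ 6 *
      Real.log (max (Real.exp 1) (2 * Real.log c)) ^ 3 * (rad a b c : ℝ) := by
  obtain ⟨ha, hb, habc, hcop⟩ := id h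
  have hc : c ≠ 0 := by omega
  have hbc : b.Coprime c := coprime_right_of_isABCTriple h
  have hac : a.Coprime c := coprime_left_of_isABCTriple h
  have habc0 : a * b * c ≠ 0 := by positivity
  have hy0 : 0 ≤ Real.log c := Real.log_nonneg (by exact_mod_cast Nat.one_le_iff_ne_zero.mpr hc)
  have hY0 : 0 ≤ Real.log (max (Real.exp 1) (2 * Real.log c)) :=
    zero_le_one.trans (one_le_log_max_exp _)
  have hΛ1 : 1 ≤ max 1 (Real.log (rad a b c : ℕ)) := le_max_left _ _
  have hK0 : 0 ≤ K := zero_le_one.trans hK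
  -- the three routes
  have hA := log_lt_route_a_of_placeBounds hK h harchA hpadA
  have hB : Real.log c < theta K a c 0 * Real.log (max (Real.exp 1) (2 * Real.log c)) *
      (1 + 3 * ∑ p ∈ b.primeFactors, (p : ℝ)) :=
    log_lt_route_a_of_placeBounds hK h.swap harchB hpadB
  have hCc := log_lt_route_c_of_placeBounds hK h hpadC
  rw [theta_zero_eq_split K hb.ne' hc hbc] at hA
  rw [theta_zero_eq_split K ha.ne' hc hac] at hB
  rw [theta_zero_eq_split K ha.ne' hb.ne' hcop] at hCc
  -- per-member accounting
  have hprime : ∀ n : ℕ, ∀ p ∈ n.primeFactors, p.Prime := fun n p hp =>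
    Nat.prime_of_mem_primeFactors hp
  have hlogle : ∀ {n : ℕ}, n ∣ a * b * c → ∀ p ∈ n.primeFactors,
      Real.log p ≤ max 1 (Real.log (rad a b c : ℕ)) := by
    intro n hn p hp
    have hp' := Nat.prime_of_mem_primeFactors hp
    have hpR : (p : ℝ) ≤ (rad a b c : ℝ) := by
      exact_mod_cast prime_le_rad hp' ((Nat.dvd_of_mem_primeFactors hp).trans hn) habc0
    have hp0 : (0 : ℝ) < p := by exact_mod_cast hp'.pos
    exact (Real.log_le_log hp0 hpR).trans (le_max_right _ _)
  have hXa := member_accounting hK hC1 hC hΛ1 a.primeFactors (hprime a)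
    (hlogle (Dvd.intro (b * c) (by ring)))
  have hXb := member_accounting hK hC1 hC hΛ1 b.primeFactors (hprime b)
    (hlogle (Dvd.intro (a * c) (by ring)))
  have hXc := member_accounting hK hC1 hC hΛ1 c.primeFactors (hprime c)
    (hlogle (Dvd.intro_left (a * b) rfl))
  -- the radical
  have hRprod : ((rad a b c : ℕ) : ℝ) = (∏ p ∈ a.primeFactors, (p : ℝ)) *
      (∏ p ∈ b.primeFactors, (p : ℝ)) * ∏ p ∈ c.primeFactors, (p : ℝ) := by
    rw [rad_def, Nat.radical_eq_prod_primeFactors, Nat.cast_prod,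
      prod_primeFactors_mul_of_coprime (mul_ne_zero ha.ne' hb.ne') hc (Nat.Coprime.mul_left hac hbc),
      prod_primeFactors_mul_of_coprime ha.ne' hb.ne' hcop]
  have hsum0 : ∀ n : ℕ, 0 ≤ ∑ p ∈ n.primeFactors, ((p : ℕ) : ℝ) := fun n =>
    Finset.sum_nonneg fun p _ => Nat.cast_nonneg p
  have key := cube_combine hK0 hy0 hY0 (hsum0 a) (hsum0 b) (hsum0 c) hA hB hCc hXa hXb hXc
  calc Real.log c ^ 3 ≤ _ := key
    _ = 64 * K ^ 9 * C ^ 3 * max 1 (Real.log (rad a b c : ℕ)) ^ 6 *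
          Real.log (max (Real.exp 1) (2 * Real.log c)) ^ 3 *
          ((∏ p ∈ a.primeFactors, (p : ℝ)) * (∏ p ∈ b.primeFactors, (p : ℝ)) *
            ∏ p ∈ c.primeFactors, (p : ℝ)) := by ring
    _ = _ := by rw [hRprod]

/-- **Stewart–Yu 2001, Theorem 1, from the three place bounds.** Suppose that for some `K ≥ 1`
and every abc triple `(a, b, c)`: (∞) `log c − log a < Θ_{bc} · Y`; (p ∣ a)
`ν_p(a) log p < Θ_{bc} · (p/log p)(log p + Y)` for every prime `p ∣ a`; and, when `ab > 1`,
(p ∣ c) `ν_p(c) log p < Θ_{ab} · (p/log p)(log p + Y)` for every prime `p ∣ c` — where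
`Θ_{uv} = theta K u v 0 = K^{ω(uv)+1} ∏_{q ∣ uv} log q` and `Y = log max{e, 2 log c}`. Then
`BakerShapeBound (1/3) 3`: `log c ≤ κ R^{1/3} (log R)³` with an absolute `κ`. The proof of
`bakerShapeBound_third_three_of_approximationBound` (the `b`-route is the `a`-route of the swapped
triple; the triple `1 + 1 = 2` is checked numerically). [cite: StewartYu2001, Theorem 1] -/
theorem bakerShapeBound_third_three_of_placeBounds (hK : 1 ≤ K)
    (harch : ∀ {a b c : ℕ}, IsABCTriple a b c →
      Real.log c - Real.log a < theta K b c 0 * Real.log (max (Real.exp 1) (2 * Real.log c)))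
    (hpad : ∀ {a b c : ℕ}, IsABCTriple a b c → ∀ {p : ℕ}, p.Prime → p ∣ a →
      (a.factorization p : ℝ) * Real.log p < theta K b c 0 *
        ((p / Real.log p) * (Real.log p + Real.log (max (Real.exp 1) (2 * Real.log c)))))
    (hpadc : ∀ {a b c : ℕ}, IsABCTriple a b c → 1 < a * b → ∀ {p : ℕ}, p.Prime → p ∣ c →
      (c.factorization p : ℝ) * Real.log p < theta K a b 0 *
        ((p / Real.log p) * (Real.log p + Real.log (max (Real.exp 1) (2 * Real.log c))))) :
    BakerShapeBound (1 / 3) 3 := by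
  obtain ⟨C, hC1, hC⟩ := exists_prod_mul_log_sq_div_le (show (0 : ℝ) ≤ 4 * K ^ 2 by positivity)
  refine ⟨64 * K ^ 3 * C * (Real.log (16 * K ^ 3 * C) + 3), fun a b c h => ?_⟩
  obtain ⟨ha, hb, habc, hcop⟩ := id h
  have hR2 : (2 : ℝ) ≤ (rad a b c : ℝ) := by
    have : 2 ≤ rad a b c := by
      rw [rad_def, Nat.two_le_radical_iff]
      calc 2 ≤ c := by omega
        _ ≤ a * b * c := Nat.le_mul_of_pos_left c (Nat.mul_pos ha hb)
    exact_mod_cast this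
  by_cases h1 : 1 < a * b
  · exact le_of_cube_le hK hC1 hR2 (log_pow_three_le_of_placeBounds hK hC1 hC h (harch h)
      (harch h.swap) (hpad h) (fun hp hpb => hpad h.swap hp hpb) (hpadc h h1))
  · -- the triple `1 + 1 = 2`
    have hab : a * b = 1 := by
      have : 1 ≤ a * b := Nat.mul_pos ha hb
      omega
    have ha1 : a = 1 := Nat.eq_one_of_mul_eq_one_right hab
    have hb1 : b = 1 := Nat.eq_one_of_mul_eq_one_left hab
    have hc2 : c = 2 := by omega
    set R : ℝ := ((rad a b c : ℕ) : ℝ) with hR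
    have hK3 : 1 ≤ K ^ 3 := one_le_pow₀ hK
    have hc₀0 : 0 ≤ Real.log (16 * K ^ 3 * C) := Real.log_nonneg (by nlinarith)
    have hκ : (192 : ℝ) ≤ 64 * K ^ 3 * C * (Real.log (16 * K ^ 3 * C) + 3) := by
      have h3 : (3 : ℝ) ≤ Real.log (16 * K ^ 3 * C) + 3 := by linarith
      calc (192 : ℝ) = 64 * 1 * 1 * 3 := by norm_num
        _ ≤ 64 * K ^ 3 * C * (Real.log (16 * K ^ 3 * C) + 3) :=
            mul_le_mul (mul_le_mul (mul_le_mul_of_nonneg_left hK3 (by norm_num)) hC1 zero_le_one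
              (by positivity)) h3 (by norm_num) (by positivity)
    have hR13 : 1 ≤ R ^ (1 / 3 : ℝ) := Real.one_le_rpow (by linarith) (by norm_num)
    have hL : (0.69 : ℝ) ≤ Real.log R :=
      le_trans (by have := Real.log_two_gt_d9; linarith) (Real.log_le_log two_pos hR2)
    have hL3 : (0.69 : ℝ) ^ 3 ≤ Real.log R ^ 3 := pow_le_pow_left₀ (by norm_num) hL 3
    have hlog2 : Real.log 2 ≤ 0.7 := by have := Real.log_two_lt_d9; linarith
    calc Real.log c = Real.log 2 := by rw [hc2]; norm_num
      _ ≤ 0.7 := hlog2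
      _ ≤ 192 * 1 * (0.69 : ℝ) ^ 3 := by norm_num
      _ ≤ 64 * K ^ 3 * C * (Real.log (16 * K ^ 3 * C) + 3) * R ^ (1 / 3 : ℝ) * Real.log R ^ 3 :=
          mul_le_mul (mul_le_mul hκ hR13 zero_le_one (by linarith)) hL3 (by norm_num)
            (by positivity)

/-- **`BakerMethodBounds` from the three place bounds** (`BakerMethodBounds` is
`BakerShapeBound (1/3) 3` by definition): the barrier declaration needs lower bounds for linear
forms in complex and `p`-adic logarithms of distinct PRIMES only, in the shape of the three
hypotheses (for some `K ≥ 1`). [cite: StewartYu2001, Theorem 1] -/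
theorem BakerMethodBounds_of_placeBounds (hK : 1 ≤ K)
    (harch : ∀ {a b c : ℕ}, IsABCTriple a b c →
      Real.log c - Real.log a < theta K b c 0 * Real.log (max (Real.exp 1) (2 * Real.log c)))
    (hpad : ∀ {a b c : ℕ}, IsABCTriple a b c → ∀ {p : ℕ}, p.Prime → p ∣ a →
      (a.factorization p : ℝ) * Real.log p < theta K b c 0 *
        ((p / Real.log p) * (Real.log p + Real.log (max (Real.exp 1) (2 * Real.log c)))))
    (hpadc : ∀ {a b c : ℕ}, IsABCTriple a b c → 1 < a * b → ∀ {p : ℕ}, p.Prime → p ∣ c →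
      (c.factorization p : ℝ) * Real.log p < theta K a b 0 *
        ((p / Real.log p) * (Real.log p + Real.log (max (Real.exp 1) (2 * Real.log c))))) :
    BakerMethodBounds :=
  bakerShapeBound_third_three_of_placeBounds hK harch hpad hpadc

end PlaceBounds

end Literature.Barriers.ABC

end
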